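import Mathlib
import Summits.NavierStokesRegularity.NavierStokesRegularity.Theorems.FilamentSkeletonRssAreaLawSlavingHoloTrace

/-!
# Area-law slaving, complex part 3 — REALNESS of the holomorphic regular solution on the real trace
# (`FilamentSkeletonRss`, child crux `TangentSkeletonNearStraight`, stmt-NavierStokesRegularity-28295, line
# `child_tangent_analytic_strip`, ∃-side of the registered stub `stub_analyticClosing`: the `StadiumAnalyticArea` conjunct)

`StadiumAnalyticArea hs L cc A` asks for `G` holomorphic on the stadium with `G t = ↑(A t)` on the real trace.  Parts 1–2
(`Theorems.AreaLawSlavingHolo.singular_regular_solution_holo(_at)`, `real_trace_solution`) give a holomorphic solution of the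
complexified area law and the calculus of real traces; this file closes the bookkeeping gap between them: when the coefficients
`a, b` are REAL on the real trace (as `(3/2 − w′)/g` and `4/g` are, `w` being the real slip continued to the stadium), the
Frobenius solution `A = e^{P}·J` of part 1 is itself real on the real trace — every ray integral `∫₀¹ w(t)·g(tx) dt` of a
function real on the trace is real (`im_integral_weight_eq_zero`), and so are `ã`, `P`, `φ = b e^{−P}`, `J`, `A` in turn.

* `im_integral_weight_eq_zero` — realness of weighted ray integrals at real points;
* `singular_regular_solution_holo_real` — part 1 with the extra conclusion `Im A(x) = 0` on the real trace;
* `singular_regular_solution_holo_at_real` — the same at a real singular point `c` of an open convex `U` (the stadium);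
* `real_trace_regular_solution` — packaged with part 2: a holomorphic `A` on `U`, real on the trace, solving
  `(z − c)·A′ = a·A + b`, `A(c) = b(c)/ν`, whose real trace `x ↦ Re A(x)` is a differentiable real solution of
  `(x − c)·A′ = Re a·A + Re b` on `{x : ℝ | ↑x ∈ U}`.

Left for the conjunct (census, unchanged): local uniqueness of the real area law on the trace interval (identification with
the slaved area of `Theorems.AreaLawSlaving` part 2), non-vanishing of the Hadamard quotient of the continued slip on a thin
stadium, and the factor-two window.

HONEST FRAMING: classical complex analysis serving a HYPOTHETICAL filament skeleton on the NEGATIVE side of a MODEL route; no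
registered stub is closed by this file and nothing here bears on Navier–Stokes regularity or blow-up.
`--supports stmt-NavierStokesRegularity-28295`.
-/

set_option linter.dupNamespace false

noncomputable section

namespace Summit.NavierStokesRegularity.NavierStokesRegularity.Theorems.AreaLawSlavingHolo

open Set MeasureTheory Metric Filter
open scoped Topology

/-! ## §1 Realness of ray integrals -/

/-- A weighted ray integral `∫₀¹ w(t)·g(t·x) dt` at a REAL point `x` is real when `g` is real at the real points `t·x`,
`t ∈ [0,1]`. (If the integrand is not integrable both sides are the junk value `0`.) [folklore] -/
theorem im_integral_weight_eq_zero {g : ℂ → ℂ} {x : ℝ} (w : ℝ → ℝ)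
    (hg : ∀ t : ℝ, t ∈ Icc (0:ℝ) 1 → (g ((t : ℂ) * x)).im = 0) :
    (∫ t in (0:ℝ)..1, (w t : ℂ) * g ((t : ℂ) * x)).im = 0 := by
  by_cases hint : IntervalIntegrable (fun t : ℝ => (w t : ℂ) * g ((t : ℂ) * x)) volume 0 1
  · have h1 := Complex.imCLM.intervalIntegral_comp_comm hint
    simp only [Complex.imCLM_apply] at h1
    rw [← h1]
    have h2 : ∫ t in (0:ℝ)..1, ((w t : ℂ) * g ((t : ℂ) * x)).im = ∫ t in (0:ℝ)..1, (0:ℝ) := by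
      refine intervalIntegral.integral_congr fun t ht => ?_
      rw [uIcc_of_le zero_le_one] at ht
      simp [Complex.mul_im, hg t ht]
    rw [h2, intervalIntegral.integral_zero]
  · rw [intervalIntegral.integral_undef hint]; simp

/-- The exponential of a complex number with zero imaginary part has zero imaginary part. [folklore] -/
theorem im_exp_eq_zero {w : ℂ} (h : w.im = 0) : (Complex.exp w).im = 0 := by
  rw [Complex.exp_im, h, Real.sin_zero, mul_zero]

/-! ## §2 The real Frobenius solution -/

/-- **Part 1 with realness.**  `U` open, star-shaped w.r.t. `0`; `a, b` holomorphic on `U`, REAL on the real trace, `a(0) = −ν`,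
`ν > 0`.  Then the holomorphic regular solution of `z·A′ = a·A + b` of part 1 may be taken REAL on the real trace. [folklore] -/
theorem singular_regular_solution_holo_real {U : Set ℂ} (hU : IsOpen U)
    (hstar : ∀ z ∈ U, ∀ t : ℝ, t ∈ Icc (0:ℝ) 1 → (t : ℂ) * z ∈ U) {ν : ℝ} (hν : 0 < ν)
    {a b : ℂ → ℂ} (ha : DifferentiableOn ℂ a U) (hb : DifferentiableOn ℂ b U) (ha0 : a 0 = -ν)
    (ha_re : ∀ x : ℝ, (x : ℂ) ∈ U → (a x).im = 0) (hb_re : ∀ x : ℝ, (x : ℂ) ∈ U → (b x).im = 0) :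
    ∃ A : ℂ → ℂ, DifferentiableOn ℂ A U ∧ (∀ z ∈ U, z * deriv A z = a z * A z + b z) ∧ A 0 = b 0 / ν ∧
      ∀ x : ℝ, (x : ℂ) ∈ U → (A x).im = 0 := by
  -- real points on rays from real points
  have hray : ∀ x : ℝ, (x : ℂ) ∈ U → ∀ t : ℝ, t ∈ Icc (0:ℝ) 1 → (((t * x : ℝ)) : ℂ) ∈ U := by
    intro x hx t ht; push_cast; exact hstar x hx t ht
  have hw1 : IntervalIntegrable (fun _ : ℝ => (1:ℝ)) volume 0 1 := intervalIntegrable_const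
  -- the Hadamard quotient `ah` of `a` at `0`: `z * ah z = a z + ν`, holomorphic on `U`, real on the trace
  obtain ⟨ah, hah⟩ : ∃ ah : ℂ → ℂ, ah = fun z => ∫ t in (0:ℝ)..1, deriv a ((t : ℂ) * z) := ⟨_, rfl⟩
  have ha' : DifferentiableOn ℂ (deriv a) U := (ha.analyticOnNhd hU).deriv.differentiableOn
  have hah_d : DifferentiableOn ℂ ah U := by
    have := differentiableOn_integral_weight_comp_mul hU hstar ha' hw1
    simp only [Complex.ofReal_one, one_mul] at this
    rw [hah]; exact this
  have hah_mul : ∀ z ∈ U, z * ah z = a z + ν := by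
    intro z hz; rw [hah]; simp only; rw [mul_integral_deriv_comp_mul hU hstar ha hz, ha0]; ring
  have hah_re : ∀ x : ℝ, (x : ℂ) ∈ U → (ah x).im = 0 := by
    intro x hx
    rw [hah]; simp only
    have h := im_integral_weight_eq_zero (g := deriv a) (x := x) (fun _ => (1:ℝ)) (fun t ht => by
      have e : (t : ℂ) * (x : ℂ) = ((t * x : ℝ) : ℂ) := by push_cast; ring
      rw [e]; exact im_deriv_eq_zero_of_real_trace hU ha ha_re (hray x hx t ht))
    simpa using h
  -- its ray primitive `P`, `P′ = ah`, `P 0 = 0`, real on the trace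
  obtain ⟨P, hP⟩ : ∃ P : ℂ → ℂ, P = fun z => z * ∫ t in (0:ℝ)..1, ah ((t : ℂ) * z) := ⟨_, rfl⟩
  have hPd : ∀ z ∈ U, HasDerivAt P (ah z) z := by
    intro z hz; rw [hP]; exact hasDerivAt_ray_primitive hU hstar hah_d hz
  have hP0 : P 0 = 0 := by rw [hP]; simp
  have hPD : DifferentiableOn ℂ P U := fun z hz => (hPd z hz).differentiableAt.differentiableWithinAt
  have hP_re : ∀ x : ℝ, (x : ℂ) ∈ U → (P x).im = 0 := by
    intro x hx
    rw [hP]; simp only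
    have h := im_integral_weight_eq_zero (g := ah) (x := x) (fun _ => (1:ℝ)) (fun t ht => by
      have e : (t : ℂ) * (x : ℂ) = ((t * x : ℝ) : ℂ) := by push_cast; ring
      rw [e]; exact hah_re _ (hray x hx t ht))
    simp only [Complex.ofReal_one, one_mul] at h
    rw [Complex.mul_im, h, Complex.ofReal_im, Complex.ofReal_re]; ring
  -- `φ = b e^{-P}`, real on the trace
  obtain ⟨φ, hφ⟩ : ∃ φ : ℂ → ℂ, φ = fun z => b z * Complex.exp (-P z) := ⟨_, rfl⟩
  have hφD : DifferentiableOn ℂ φ U := by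
    rw [hφ]; exact hb.mul (hPD.neg.cexp)
  have hEφ : ∀ z, Complex.exp (P z) * φ z = b z := by
    intro z; rw [hφ]; simp only
    rw [Complex.exp_neg, mul_comm (b z), ← mul_assoc, mul_inv_cancel₀ (Complex.exp_ne_zero _), one_mul]
  have hφ_re : ∀ x : ℝ, (x : ℂ) ∈ U → (φ x).im = 0 := by
    intro x hx
    rw [hφ]; simp only
    have h1 : (Complex.exp (-P x)).im = 0 := im_exp_eq_zero (by rw [Complex.neg_im, hP_re x hx, neg_zero])
    rw [Complex.mul_im, h1, hb_re x hx]; ring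
  -- the Euler transform `J` of `φ` and its derivative `J'`
  have hwν : IntervalIntegrable (fun t : ℝ => t ^ (ν - 1)) volume 0 1 :=
    intervalIntegral.intervalIntegrable_rpow' (by linarith)
  obtain ⟨J, hJ⟩ : ∃ J : ℂ → ℂ, J = fun z => ∫ t in (0:ℝ)..1, ((t ^ (ν - 1) : ℝ) : ℂ) * φ ((t : ℂ) * z) := ⟨_, rfl⟩
  obtain ⟨J', hJ'⟩ : ∃ J' : ℂ → ℂ,
      J' = fun z => ∫ t in (0:ℝ)..1, ((t ^ (ν - 1) : ℝ) : ℂ) * (deriv φ ((t : ℂ) * z) * t) := ⟨_, rfl⟩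
  have hJd : ∀ z ∈ U, HasDerivAt J (J' z) z := by
    intro z hz; rw [hJ, hJ']; exact hasDerivAt_integral_weight_comp_mul hU hstar hφD hwν hz
  have hJeuler : ∀ z ∈ U, z * J' z = φ z - ν * J z := by
    intro z hz; rw [hJ, hJ']; exact euler_identity hU hstar hν hφD hz
  have hJ0 : J 0 = φ 0 / ν := by rw [hJ]; exact eulerIntegral_zero hν φ
  have hJ_re : ∀ x : ℝ, (x : ℂ) ∈ U → (J x).im = 0 := by
    intro x hx
    rw [hJ]; simp only
    exact im_integral_weight_eq_zero (g := φ) (x := x) (fun t => t ^ (ν - 1)) (fun t ht => by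
      have e : (t : ℂ) * (x : ℂ) = ((t * x : ℝ) : ℂ) := by push_cast; ring
      rw [e]; exact hφ_re _ (hray x hx t ht))
  -- `A = e^P J`
  have hA : ∀ z ∈ U, HasDerivAt (fun z => Complex.exp (P z) * J z)
      (Complex.exp (P z) * ah z * J z + Complex.exp (P z) * J' z) z :=
    fun z hz => ((hPd z hz).cexp).mul (hJd z hz)
  refine ⟨fun z => Complex.exp (P z) * J z, fun z hz => (hA z hz).differentiableAt.differentiableWithinAt,
    fun z hz => ?_, ?_, fun x hx => ?_⟩
  · rw [(hA z hz).deriv]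
    calc z * (Complex.exp (P z) * ah z * J z + Complex.exp (P z) * J' z)
        = Complex.exp (P z) * ((z * ah z) * J z + z * J' z) := by ring
      _ = Complex.exp (P z) * ((a z + ν) * J z + (φ z - ν * J z)) := by rw [hah_mul z hz, hJeuler z hz]
      _ = a z * (Complex.exp (P z) * J z) + Complex.exp (P z) * φ z := by ring
      _ = a z * (Complex.exp (P z) * J z) + b z := by rw [hEφ]
  · simp only [hP0, Complex.exp_zero, one_mul, hJ0]
    have : φ 0 = b 0 := by rw [hφ]; simp [hP0]
    rw [this]
  · show (Complex.exp (P x) * J x).im = 0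
    rw [Complex.mul_im, im_exp_eq_zero (hP_re x hx), hJ_re x hx]; ring

/-- **Holomorphic, trace-real regular solution at a REAL singular point of a convex domain.**  `U` open convex, `c : ℝ` with
`↑c ∈ U`; `a, b` holomorphic on `U`, real on the real trace, `a(c) = −ν`, `ν > 0`.  Then there is `A` holomorphic on `U`, REAL
on the real trace, with `(z − c)·A′(z) = a(z)·A(z) + b(z)` on `U` and `A(c) = b(c)/ν`. [folklore] -/
theorem singular_regular_solution_holo_at_real {U : Set ℂ} (hUo : IsOpen U) (hUc : Convex ℝ U) {c : ℝ}
    (hc : (c : ℂ) ∈ U) {ν : ℝ} (hν : 0 < ν) {a b : ℂ → ℂ} (ha : DifferentiableOn ℂ a U) (hb : DifferentiableOn ℂ b U)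
    (hac : a c = -ν) (ha_re : ∀ x : ℝ, (x : ℂ) ∈ U → (a x).im = 0) (hb_re : ∀ x : ℝ, (x : ℂ) ∈ U → (b x).im = 0) :
    ∃ A : ℂ → ℂ, DifferentiableOn ℂ A U ∧ (∀ z ∈ U, (z - c) * deriv A z = a z * A z + b z) ∧ A c = b c / ν ∧
      ∀ x : ℝ, (x : ℂ) ∈ U → (A x).im = 0 := by
  set V : Set ℂ := (fun z => z - (c : ℂ)) '' U with hV
  have hVo : IsOpen V := isOpen_image_sub hUo c
  have hstar := star_of_convex hUc hc
  have hsh : ∀ {g : ℂ → ℂ}, DifferentiableOn ℂ g U → DifferentiableOn ℂ (fun z => g (z + c)) V := by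
    intro g hg
    refine (hg.comp ((differentiable_id.add_const (c : ℂ)).differentiableOn) ?_)
    rintro _ ⟨u, hu, rfl⟩; simpa using hu
  have hsh_re : ∀ {g : ℂ → ℂ}, (∀ x : ℝ, (x : ℂ) ∈ U → (g x).im = 0) →
      ∀ x : ℝ, (x : ℂ) ∈ V → (g ((x : ℂ) + c)).im = 0 := by
    intro g hg x hx
    obtain ⟨u, hu, hux⟩ := hx
    have hu' : u = ((x + c : ℝ) : ℂ) := by
      push_cast; rw [← hux]; ring
    have : (x : ℂ) + c = ((x + c : ℝ) : ℂ) := by push_cast; ring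
    rw [this]
    exact hg (x + c) (by rw [← hu']; exact hu)
  obtain ⟨A, hA, hODE, hA0, hAre⟩ := singular_regular_solution_holo_real hVo hstar hν (hsh ha) (hsh hb)
    (by simpa using hac) (hsh_re ha_re) (hsh_re hb_re)
  refine ⟨fun z => A (z - c), ?_, fun z hz => ?_, by simpa using hA0, fun x hx => ?_⟩
  · refine hA.comp ((differentiable_id.sub_const (c : ℂ)).differentiableOn) fun z hz => ⟨z, hz, rfl⟩
  · have hzV : z - c ∈ V := ⟨z, hz, rfl⟩
    have h1 := hODE (z - c) hzV
    simp only [sub_add_cancel] at h1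
    have hd : deriv (fun z => A (z - c)) z = deriv A (z - c) := by
      have hAd : DifferentiableAt ℂ A (z - c) := hA.differentiableAt (hVo.mem_nhds hzV)
      have := (hAd.hasDerivAt.comp z ((hasDerivAt_id z).sub_const (c : ℂ)))
      simp only [mul_one] at this
      exact this.deriv
    rw [hd]
    exact h1
  · show (A ((x : ℂ) - c)).im = 0
    have e : (x : ℂ) - c = ((x - c : ℝ) : ℂ) := by push_cast; ring
    rw [e]
    exact hAre (x - c) ⟨x, hx, by push_cast; ring⟩

/-- **The regular solution and its real trace, packaged.**  Under the hypotheses of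
`singular_regular_solution_holo_at_real`: a holomorphic `A` on `U`, real on the real trace, solving `(z − c)·A′ = a·A + b` with
`A(c) = b(c)/ν`, whose real trace `x ↦ Re A(x)` is differentiable with derivative `Re A′(x)` and solves the REAL singular
equation `(x − c)·(Re A)′(x) = Re a(x)·Re A(x) + Re b(x)` at every `x` with `↑x ∈ U`. [folklore] -/
theorem real_trace_regular_solution {U : Set ℂ} (hUo : IsOpen U) (hUc : Convex ℝ U) {c : ℝ}
    (hc : (c : ℂ) ∈ U) {ν : ℝ} (hν : 0 < ν) {a b : ℂ → ℂ} (ha : DifferentiableOn ℂ a U) (hb : DifferentiableOn ℂ b U)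
    (hac : a c = -ν) (ha_re : ∀ x : ℝ, (x : ℂ) ∈ U → (a x).im = 0) (hb_re : ∀ x : ℝ, (x : ℂ) ∈ U → (b x).im = 0) :
    ∃ A : ℂ → ℂ, DifferentiableOn ℂ A U ∧ (∀ z ∈ U, (z - c) * deriv A z = a z * A z + b z) ∧ A c = b c / ν ∧
      (∀ x : ℝ, (x : ℂ) ∈ U → (A x).im = 0) ∧
      ∀ x : ℝ, (x : ℂ) ∈ U →
        HasDerivAt (fun t : ℝ => (A t).re) ((deriv A x).re) x ∧
          (x - c) * deriv (fun t : ℝ => (A t).re) x = (a x).re * (A x).re + (b x).re := by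
  obtain ⟨A, hA, hODE, hA0, hAre⟩ := singular_regular_solution_holo_at_real hUo hUc hc hν ha hb hac ha_re hb_re
  exact ⟨A, hA, hODE, hA0, hAre, fun x hx => real_trace_solution hUo hA hODE ha_re hAre hx⟩

end Summit.NavierStokesRegularity.NavierStokesRegularity.Theorems.AreaLawSlavingHolo
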